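import Mathlib
import Summits.ValiantsHypothesis.ValiantsHypothesis.Theorems.BarrierLeverPartitionMinorsHitByVPHiddenStatesSymbolicStep

/-!
# Route BarrierLever — item `PartitionMinorsHitByVP` (stmt-ValiantsHypothesis-19717), line `hidden-states`:
# THE FITTING CERTIFICATE `Fit` (an inductive Prop) and the typed sufficient form `Stmt.fitConjecture` of the conjecture node

Helper file (`--supports stmt-ValiantsHypothesis-19717`; cell valiant-natproofs, rung V4, 𝒟-side door (c), registered line
`Cruxes/PartitionMinorsHitByVP/Lines/hidden_states.lean` v2, lane `stub_universalJoinWide`; prover seat val-np-p3 gen 10).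
Declares the inductive certificate predicate `Fit`, the Prop `Stmt.fitConjecture` (a CONJECTURE, not asserted), and the verbatim body
`Stmt.universalJoinWide` of the line's `Stmt.stub_universalJoinWide` (the Cruxes module is not importable). Closes NO item.

THE POINT (memo val-np-p3 g10 §10–§14, PROBLEM-FplusPeel-valnp3-g10.md). A certificate of the recursive fitting criterion F⁺ is a finite tree:
leaves = configurations whose columns sit in pairwise distinct pieces (`SymbJoin.symGood_of_lonely`), internal nodes = one hyperplane cut per
piece along a coordinate `x` (`SymbJoin.symGood_of_split_enum`). `Fit u e` is exactly «such a tree exists» as an inductive proposition, and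
`Fit.symDet_ne_zero` turns it into generic goodness, `Fit.exists_table` into the numeric `∃ tx, det ≠ 0` of the stubs. Hence the combinatorial
CONJECTURE `Stmt.fitConjecture` — for all large `h` and all `r ≤ 2^h` some legal join threshold family (`m ≤ 2h`, `K ≤ h³`) is `Fit`-certified
against every injective row family — implies the conjecture node verbatim (`universalJoinWide_of_fitConjecture`). The census (lab/fitpeel.py;
kit j294316) finds `Fit` certificates for the fully peeled greedy-ball design on every tested family (h ≤ 9, adaptive coordinate order); the
certificate compiler lab/cert2lean.py emits them as Lean terms (demo `…HiddenStatesCertDemo`).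

WHAT THIS IS NOT: `Stmt.fitConjecture` is OPEN (a conjecture, typed here so that the planner can register it as the node's sufficient form);
nothing is asserted about it; item 19717 OPEN; nothing on crux 14610 or VP ≠ VNP.
-/

set_option linter.dupNamespace false

namespace Summit.ValiantsHypothesis.ValiantsHypothesis.Theorems.BarrierLever.HiddenStates

open Finset Matrix MvPolynomial

noncomputable section

namespace SymbJoin

variable {h m K : ℕ}

/-- **The fitting certificate.** `Fit u e` holds if either the columns of `e` lie in pairwise distinct pieces and `u` is injective (leaf), or
there are a coordinate `x`, cut constants `β, γ` and enumerations of the deletion rows / link rows / unscaled columns / scaled columns (as in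
`symGood_of_split_enum`) such that both the deletion configuration and the link configuration are `Fit` (node). -/
inductive Fit : {r : ℕ} → (Fin r → Finset (Fin h)) → (Fin r → Fin m × Finset (Fin K)) → Prop
  | lonely {r : ℕ} (u : Fin r → Finset (Fin h)) (e : Fin r → Fin m × Finset (Fin K))
      (hu : Function.Injective u) (hl : Function.Injective fun k => (e k).1) : Fit u e
  | split {r r₀ r₁ : ℕ} (u : Fin r → Finset (Fin h)) (e : Fin r → Fin m × Finset (Fin K)) (x : Fin h)
      (β : Fin m → ℂ) (γ : Fin m → Fin K → ℂ) (hr : r₀ + r₁ = r)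
      (f₀ : Fin r₀ → Fin r) (f₁ : Fin r₁ → Fin r) (g₀ : Fin r₀ → Fin r) (g₁ : Fin r₁ → Fin r)
      (hf : Function.Injective (Sum.elim f₀ f₁)) (hg : Function.Injective (Sum.elim g₀ g₁))
      (hrow0 : ∀ j, x ∉ u (f₀ j)) (hrow1 : ∀ j, x ∈ u (f₁ j))
      (hcol0 : ∀ j, xi e β γ (g₀ j) = 0) (hcol1 : ∀ j, xi e β γ (g₁ j) ≠ 0)
      (h0 : Fit (fun j : Fin r₀ => u (f₀ j)) (fun j => e (g₀ j)))
      (h1 : Fit (fun j : Fin r₁ => (u (f₁ j)).erase x) (fun j => e (g₁ j))) : Fit u e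

/-- **A fitting certificate proves generic goodness.** -/
theorem Fit.symDet_ne_zero {r : ℕ} {u : Fin r → Finset (Fin h)} {e : Fin r → Fin m × Finset (Fin K)} (hF : Fit u e) :
    symDet u e ≠ 0 := by
  induction hF with
  | lonely u e hu hl => exact symGood_of_lonely u hu e hl
  | split u e x β γ hr f₀ f₁ g₀ g₁ hf hg hrow0 hrow1 hcol0 hcol1 _ _ ih0 ih1 =>
    exact symGood_of_split_enum u e x β γ hr f₀ f₁ g₀ g₁ hf hg hrow0 hrow1 hcol0 hcol1 ih0 ih1

/-- **… hence the numeric `∃ tx, det ≠ 0` of the line's stubs.** -/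
theorem Fit.exists_table {r : ℕ} {u : Fin r → Finset (Fin h)} {e : Fin r → Fin m × Finset (Fin K)} (hF : Fit u e) :
    ∃ tx : Fin m → Option (Fin K) → Fin h → ℂ,
      (Matrix.of fun i k : Fin r =>
        ∏ a ∈ u i, (tx (e k).1 none a + ∑ q ∈ (e k).2, tx (e k).1 (some q) a)).det ≠ 0 :=
  exists_table_of_symGood u e hF.symDet_ne_zero

/-! ## The typed conjecture and its consequence for the node -/

/-- The body of the line's `Stmt.stub_universalJoinWide` (file `Cruxes/PartitionMinorsHitByVP/Lines/hidden_states.lean`), VERBATIM: ONE legal wide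
join threshold family per `(h, r)` that is good for every injective row family. -/
def Stmt.universalJoinWide : Prop :=
  ∃ h₁ : ℕ, ∀ h : ℕ, h₁ ≤ h → ∀ r : ℕ, r ≤ 2 ^ h →
    ∃ (m K : ℕ) (W : Fin m → ℕ) (wt : Fin m → Fin K → ℕ) (e : Fin r → Fin m × Finset (Fin K)),
      m ≤ h + h ∧ K ≤ h * h * h ∧ Function.Injective e ∧
      (∀ x : Fin m × Finset (Fin K), x ∉ Set.range e →
        ∀ i, W (e i).1 + ∑ k ∈ (e i).2, wt (e i).1 k < W x.1 + ∑ k ∈ x.2, wt x.1 k) ∧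
      ∀ u : Fin r → Finset (Fin h), Function.Injective u →
        ∃ tx : Fin m → Option (Fin K) → Fin h → ℂ,
          (Matrix.of fun i k : Fin r =>
            ∏ a ∈ u i, (tx (e k).1 none a + ∑ q ∈ (e k).2, tx (e k).1 (some q) a)).det ≠ 0

/-- **CONJECTURE (F⁺, typed; not asserted).** For all large `h` and every `r ≤ 2^h` there is ONE legal wide join threshold family (`m ≤ 2h`
pieces, `K ≤ h³` states) that is `Fit`-certified against EVERY injective row family `u : Fin r → Finset (Fin h)`. The census supports it for
the fully peeled greedy-ball design (memo §12–§14); it is the proposed sufficient form of the conjecture node. -/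
def Stmt.fitConjecture : Prop :=
  ∃ h₁ : ℕ, ∀ h : ℕ, h₁ ≤ h → ∀ r : ℕ, r ≤ 2 ^ h →
    ∃ (m K : ℕ) (W : Fin m → ℕ) (wt : Fin m → Fin K → ℕ) (e : Fin r → Fin m × Finset (Fin K)),
      m ≤ h + h ∧ K ≤ h * h * h ∧ Function.Injective e ∧
      (∀ x : Fin m × Finset (Fin K), x ∉ Set.range e →
        ∀ i, W (e i).1 + ∑ k ∈ (e i).2, wt (e i).1 k < W x.1 + ∑ k ∈ x.2, wt x.1 k) ∧
      ∀ u : Fin r → Finset (Fin h), Function.Injective u → Fit u e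

/-- **The conjecture node from the fitting conjecture** (`b`-free: the statement is the node's body verbatim). -/
theorem universalJoinWide_of_fitConjecture (hC : Stmt.fitConjecture) : Stmt.universalJoinWide := by
  obtain ⟨h₁, H⟩ := hC
  refine ⟨h₁, fun h hh r hr => ?_⟩
  obtain ⟨m, K, W, wt, e, hm, hK, he, hthr, hfit⟩ := H h hh r hr
  exact ⟨m, K, W, wt, e, hm, hK, he, hthr, fun u hu => (hfit u hu).exists_table⟩

end SymbJoin

end

end Summit.ValiantsHypothesis.ValiantsHypothesis.Theorems.BarrierLever.HiddenStates
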